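import Literature.NumberTheory.Rogawski1990.RankOneUnstableDeltaSymbolTorusCoordinates   -- ★ p844015 (B-p12 (g30)) (W′5′-ALG): `cayley_eq_numerator_coords`, `valued_toPlace_trc_sub_four`, the coordinates `bc, tc`
import HarnessLib

/-!
# [LabesseLanglands1979 §2 (2.2); Labesse2024 Prop. 0.0.11, Th. 0.0.12] road «W′» = «R1LL-WILD», brick (Ψ4)-Δ: SIGN AND EXPONENT BOOKKEEPING for the torus coordinates
# `bc, tc` of ★ `RankOneUnstableDeltaSymbolTorusCoordinates` — any numerator, `|ι_w bc|_w`, `|ι_w tc|_w = |4|_w`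

Topic `NumberTheory/Rogawski1990`; namespace `Literature.NumberTheory.Rogawski1990`.  THEOREMS ONLY (no definition, no instance, no notation, no named fact, no `sorry`).
Cell `pub/hodgecm-mathlib` (D-0151), crux H413 = `stmt-HodgeConjecture-24833`, line «N6nsGerm», wild residue `stub_N6nsR1ramWild`; architect A-p16 (g28) RULINGS A-37 (Ψ4)
«sign∕exponent bookkeeping `κ(β)·q^{ord β} = (b₀,θ)_v·(r_η,θ)(t_λ,θ)·q^{…}`» ∕ A-38 (a); hand B-p12 (g30).  Sibling of ★ p844015 (kept ≤ 400 lines).  HONEST LABEL: HC_CM is proved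
only modulo the printed citations (the 2 remaining named inputs hLiu418, h413) until rung 0 closes; nothing printed is asserted here.

THE MATHEMATICS (tokens of ★ p844015: `a c : E_v = LocalRing L v` norm-one, `z = a_w∕c_w`, skew `η`, `ι = toPlace v w`, `σ = σ_w`).
* `toPlace_cayley_eq_div_of_numerator_coords`: for ANY Hilbert-90 numerator `x = z·σx` (the D-side's own `λ = a′ + b′τ`, [Labesse2024 Prop. 0.0.11]) with coordinates
  `ι bx = (x − σx)∕η`, `ι tx = x + σx`: `ι (bx·tx⁻¹) = (z − 1)∕((z + 1)η)` — so R-4's `(b₀, θ)_v = (bx, θ)_v·(tx, θ)_v` for that numerator (★ `hilbertSymbol_eq_mul_of_toPlace_eq_div`):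
  the SIGN line of (Ψ4) (`κ(b_λ)·(r_η,θ)_v = (b₀,θ)_v·(t_λ,θ)_v` once `ι bx = b_λ·(τ − τ̄)∕η`).
* `valued_toPlace_bcoord_eq`: on the deep locus `|a_w − c_w|_w < |2|_w`, the canonical difference coordinate has `|ι bc|_w = |a_w − c_w|_w·|2|_w·|η|_w⁻¹`
  (`z − z⁻¹ = (z−1)(z+1)∕z`, `|z + 1|_w = |2 + (z−1)|_w = |2|_w`): the EXPONENT line (`2·ord_v bc = N t + ord_w 2 − ord_w η`, `e(w|v) = 2`).
* `valued_toPlace_trc_eq`: `|ι tc|_w = |4|_w` there (`ι tc = 4 + (a_w − c_w)²∕(a_w c_w)`, ★ `valued_toPlace_trc_sub_four`); hence `|ι b₀|_w = |a_w − c_w|_w∕(|2|_w|η|_w)`.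

## References
* [LabesseLanglands1979] J.-P. Labesse, R. P. Langlands, *L-indistinguishability for SL(2)*, Canad. J. Math. 31 (1979): §2 (2.1)–(2.2) pp. 7–9.
* [Labesse2024StabilisationGermesSL2] J.-P. Labesse, *Stabilisation des germes de SL(2)* (arXiv:2411.14820, 2024): Prop. 0.0.11, Th. 0.0.12 pp. 7–8.
* [Rogawski1990] J. D. Rogawski, *Automorphic Representations of Unitary Groups in Three Variables*, Ann. of Math. Stud. 123 (1990): §4.9 Lemma 4.9.3, (4.9.2) p. 56.
-/

set_option autoImplicit false

noncomputable section

open NumberField IsDedekindDomain Filter Topology ValuativeRel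
open scoped ValuativeRel

namespace Literature.NumberTheory.Rogawski1990

open Literature.NumberTheory.Automorphic Literature.NumberTheory.Automorphic.UnitaryGroup Literature.NumberTheory.GaloisRepresentations
open Literature.NumberTheory.QuadraticForms Literature.NumberTheory.NumberFields

variable (L : Type) [Field L] [NumberField L] [IsCMField L] (v : HeightOneSpectrum (𝓞 ↥(maximalRealSubfield L)))
  (w : PlacesOver L v) (hw : IsCMField.complexConj L • w.1 = w.1)

/-- **ANY NUMERATOR'S COORDINATES GIVE THE CAYLEY PARAMETER** (sign bookkeeping for the D-side's own `λ`, (Ψ4)): if `x = (a_w∕c_w) · σ_w x` (a Hilbert-90 numerator of the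
eigenvalue ratio, e.g. the `λ = a′ + b′τ` whose regular representation acts on the tree), `σ_w x ≠ 0`, `x + σ_w x ≠ 0`, and `ι_w bx = (x − σ_w x)∕η`, `ι_w tx = x + σ_w x` for units
`bx, tx` of `L⁺_v`, then `ι_w (bx · tx⁻¹) = (a_w∕c_w − 1)∕((a_w∕c_w + 1)·η)` — so `(b₀, θ)_v = (bx, θ)_v · (tx, θ)_v` for THAT numerator too (`hilbertSymbol_eq_mul_of_toPlace_eq_div`).
[cite: Labesse2024StabilisationGermesSL2, Prop. 0.0.11 (`κ(c₂) = κ(det x̃)·κ(b)`)] [cite: LabesseLanglands1979, §2 (2.1)] -/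
theorem toPlace_cayley_eq_div_of_numerator_coords {η x : w.1.adicCompletion L} {a c : LocalRing L v}
    (hx : x = (a w / c w) * galAdicCompletionMap (L := L) (IsCMField.complexConj L) hw x)
    (hσx : galAdicCompletionMap (L := L) (IsCMField.complexConj L) hw x ≠ 0) (hsum : x + galAdicCompletionMap (L := L) (IsCMField.complexConj L) hw x ≠ 0)
    {bx tx : (v.adicCompletion ↥(maximalRealSubfield L))ˣ}
    (hbx : toPlace v w (bx : v.adicCompletion ↥(maximalRealSubfield L)) = (x - galAdicCompletionMap (L := L) (IsCMField.complexConj L) hw x) / η)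
    (htx : toPlace v w (tx : v.adicCompletion ↥(maximalRealSubfield L)) = x + galAdicCompletionMap (L := L) (IsCMField.complexConj L) hw x) :
    toPlace v w ((bx * tx⁻¹ : (v.adicCompletion ↥(maximalRealSubfield L))ˣ) : v.adicCompletion ↥(maximalRealSubfield L)) =
      (a w / c w - 1) / ((a w / c w + 1) * η) := by
  rw [Units.val_mul, Units.val_inv_eq_inv_val, map_mul, map_inv₀, hbx, htx, ← div_eq_mul_inv]
  exact (cayley_eq_numerator_coords (galAdicCompletionMap (L := L) (IsCMField.complexConj L) hw) hx hσx hsum).symm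

include hw in
/-- **EXPONENT BOOKKEEPING FOR THE DIFFERENCE COORDINATE** ((Ψ4)): for norm-one `a, c` DEEP in the sense `|a_w − c_w|_w < |2|_w` and a skew `η ≠ 0`, the canonical difference
coordinate has `|ι_w bc|_w = |a_w − c_w|_w · |2|_w · |η|_w⁻¹` (`z − z⁻¹ = (z − 1)(z + 1)∕z`, `|z|_w = 1`, `|z − 1|_w = |a_w − c_w|_w`, `|z + 1|_w = |2 + (z − 1)|_w = |2|_w`).  Hence
`2·ord_v bc = N t + ord_w 2 − ord_w η` on the deep locus (`e(w|v) = 2`). [cite: LabesseLanglands1979, §2 (2.2) (`|b|`, `δ_m = 2q^m`)] [cite: Labesse2024StabilisationGermesSL2, Th. 0.0.12] -/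
theorem valued_toPlace_bcoord_eq {η : w.1.adicCompletion L} (hη0 : η ≠ 0) {a c : LocalRing L v} (ha : conjLocal L (IsCMField.complexConj L) v a * a = 1)
    (hc : conjLocal L (IsCMField.complexConj L) v c * c = 1) (hdeep : Valued.v (a w - c w) < Valued.v (2 : w.1.adicCompletion L))
    {bc : (v.adicCompletion ↥(maximalRealSubfield L))ˣ} (hbc : toPlace v w (bc : v.adicCompletion ↥(maximalRealSubfield L)) = (a w / c w - c w / a w) / η) :
    Valued.v (toPlace v w (bc : v.adicCompletion ↥(maximalRealSubfield L))) = Valued.v (a w - c w) * Valued.v (2 : w.1.adicCompletion L) * (Valued.v η)⁻¹ := by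
  have hva : Valued.v (a w) = 1 := valued_apply_eq_one_of_conjLocal_mul_self L v w hw ha
  have hvc : Valued.v (c w) = 1 := valued_apply_eq_one_of_conjLocal_mul_self L v w hw hc
  have ha0 : a w ≠ 0 := fun h0 => by rw [h0, map_zero] at hva; exact zero_ne_one hva
  have hc0 : c w ≠ 0 := fun h0 => by rw [h0, map_zero] at hvc; exact zero_ne_one hvc
  have hfac : (a w / c w - c w / a w) / η = (a w - c w) * ((a w - c w) + 2 * c w) / (a w * c w * η) := by
    field_simp
    ring
  have h2c : Valued.v ((a w - c w) + 2 * c w) = Valued.v (2 : w.1.adicCompletion L) := by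
    have hlt : Valued.v (a w - c w) < Valued.v (2 * c w) := by rw [Valuation.map_mul, hvc, mul_one]; exact hdeep
    rw [Valued.v.map_add_eq_of_lt_right hlt, Valuation.map_mul, hvc, mul_one]
  rw [hbc, hfac, Valuation.map_div, Valuation.map_mul, Valuation.map_mul, Valuation.map_mul, h2c, hva, hvc, one_mul, one_mul, div_eq_mul_inv]

include hw in
/-- **EXPONENT BOOKKEEPING FOR THE TRACE COORDINATE** ((Ψ4)): for norm-one `a, c` with `|a_w − c_w|_w < |2|_w`, `|ι_w tc|_w = |4|_w` (`ι tc = 4 + (a_w − c_w)²∕(a_w c_w)` and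
`|(a_w − c_w)²| < |4|`).  With `valued_toPlace_bcoord_eq`: `|ι_w b₀|_w = |ι bc|∕|ι tc| = |a_w − c_w|_w ∕ (|2|_w·|η|_w)`. [cite: LabesseLanglands1979, §2 (2.2)] -/
theorem valued_toPlace_trc_eq {a c : LocalRing L v} (ha : conjLocal L (IsCMField.complexConj L) v a * a = 1)
    (hc : conjLocal L (IsCMField.complexConj L) v c * c = 1) (hdeep : Valued.v (a w - c w) < Valued.v (2 : w.1.adicCompletion L))
    {tc : (v.adicCompletion ↥(maximalRealSubfield L))ˣ} (htc : toPlace v w (tc : v.adicCompletion ↥(maximalRealSubfield L)) = a w / c w + c w / a w + 2) :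
    Valued.v (toPlace v w (tc : v.adicCompletion ↥(maximalRealSubfield L))) = Valued.v (4 : w.1.adicCompletion L) := by
  have h4 := valued_toPlace_trc_sub_four L v w hw ha hc htc
  have hlt : Valued.v (toPlace v w (tc : v.adicCompletion ↥(maximalRealSubfield L)) - 4) < Valued.v (4 : w.1.adicCompletion L) := by
    rw [h4, show (4 : w.1.adicCompletion L) = 2 * 2 by norm_num, Valuation.map_mul, ← sq]
    exact pow_lt_pow_left₀ hdeep zero_le two_ne_zero
  have := Valued.v.map_add_eq_of_lt_right hlt
  rwa [sub_add_cancel] at this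

end Literature.NumberTheory.Rogawski1990

end
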